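import Mathlib
import HarnessLib
import Literature.AlgebraicGeometry.CossartPiltant200819.OrderAtClosedPoint2009

/-!
# [CP-II] ch.1 II.5.3.2 (i) one dimension up, continued: a closed point of `𝔸²` on NO rational line —
# `x′ = (θ, θ²)` — and a cubic of order exactly two there (census OBSTRUCTIONS-DIM4 §35.11)

Companion of `CossartPiltant200819/OrderAtClosedPoint2009` (p185571). That module showed that the estimate
[CP-II] ch.1 II.5.3.2 (i) (J. Algebra 321 (2009) p. 1862; = [CP 2019] Lemma 6.3 of arXiv:1412.0868v1 = Lemma 6.7
of v2) — "order at the closed point `x′` of the exceptional LINE, of residue degree `d`, is `≤ 1 + i/d`" — keeps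
only its dimension-free part "order `≤ 1 +` degree" when the exceptional fibre has TWO transverse parameters, and
refuted the verbatim `1/d` at a non-rational point lying on a rational line (`(w₂, Q(w₃))`, `F = U₂ⁱ`). The present
module treats the OTHER kind of non-rational closed point of `𝔸²_k` — one lying on no `k`-rational line — and
shows that the residue degree does not govern the order there either; what does is the INITIAL DEGREE
`ν(x′) := min{deg H : 0 ≠ H ∈ 𝔪_{x′}}` of the point, through Chudnovsky's theorem on points of `ℙ²`
(`α(I^{(m)})/m ≥ (α(I)+1)/2`; B. Harbourne, C. Huneke, J. Ramanujan Math. Soc. 28A (2013), Prop. 3.0.8, with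
proof — NOT reproduced here; it gives `ord_{x′} G ≤ 2·deg G/(ν(x′)+1)` for separable `k(x′)/k`, see the
census text). [cite: CossartPiltant2009, ch.1 II.5.3.2 (i), p. 1862] [cite: CossartPiltant2019, Lemma 6.3 (arXiv v1)
= Lemma 6.7 (arXiv v2)] [cite: HarbourneHuneke2013, Prop. 3.0.8 (context only)]
Caveat: AI-typed census material (folklore computations); not refereed by a human; NOT a result of the cited
papers — it probes the verbatim lift of their one-parameter estimate.

RESULTS (kernel-checked; `k` any field, `P ∈ k[T]`, `θ` = the class of `T` in `k[T]/(P)`).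
* `sub_aeval_sq_mem_span`, `aeval_X0_aeval_T_sq`, `aeval_root_sq_surjective`, **`ker_aeval_root_sq_eq`**: the
  closed point `x′ = (θ, θ²) ∈ 𝔸²_k = Spec k[w₂,w₃]` has maximal ideal
  `𝔪 = (P(w₂), w₃ − w₂²) = ker(w₂ ↦ θ, w₃ ↦ θ²)`; `isMaximal` (`P` irreducible); `finrank_residueField`
  (`[k(x′):k] = deg P`).
* **`linear_not_mem`**: if `deg P ≥ 3`, NO nonzero affine-linear polynomial `a + b w₂ + c w₃` lies in `𝔪` — `x′`
  lies on no `k`-rational line (`a + bθ + cθ² = 0` would make `P` divide a nonzero polynomial of degree `≤ 2`);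
  `conic_mem`: the conic `w₃ − w₂²` lies in `𝔪` — so `ν(x′) = 2`.
* Over `k = 𝔽₂`, `P = T³ + T + 1` (`P2_irreducible`, by root count), `d = 3`: the cubic
  `C = 1 + w₃² + w₃³ + w₂w₃ + w₂² + w₂²w₃ + w₂³` (over `𝔽₈`: the product of the three lines through the pairs
  of conjugates of `x′`, `C = N_{𝔽₈/𝔽₂}(θ² + w₂θ + w₃ + 1)`) satisfies `cubic_eq`
  (`C = P(w₂)² + w₂P(w₂)(w₃−w₂²) + (1+w₃)(w₃−w₂²)²`, an identity mod `2`), hence **`cubic_mem_sq`** (`C ∈ 𝔪²`);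
  `pderiv_one_cubic`, `pderiv_pderiv_cubic` (`∂²C/∂w₂∂w₃ = 1`) hence **`cubic_not_mem_cube`** (`C ∉ 𝔪³`, by
  `OrderAtClosedPoint.derivation_apply_mem_pow` twice: order EXACTLY `2`); `cubic_totalDegree_le` (`deg C ≤ 3`).
* **`caseG_witness`**: at `x′` (maximal, residue degree `3`, on no rational line) `C` has order `2 > 3/3 =
  deg/d` — the verbatim lift of (22)(ii) of [CP-I] Lemma 4.5 fails off rational lines too — while
  `2 = 2·3/(ν+1)` attains Chudnovsky's bound; **`caseG_violates_verbatim`**: `G = C·(w₃ − w₂²)` has order `≥ 3`,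
  degree `≤ 5`, `∂G/∂w₃ ≠ 0` (not a square: the hypothesis "`∉ (k[U])ᵖ`" of II.5.3.2 holds), and
  `3 > 1 + 5/3` — the verbatim two-parameter II.5.3.2 (i) fails at a point on no rational line
  (Chudnovsky: `≤ 2·5/3`, respected).

DIMENSION (census reading, OBSTRUCTIONS-DIM4 §35.11): with two transverse parameters the very near closed
points of the exceptional `ℙ²` come in three kinds — rational; non-rational on a rational line (p185571's
witness); on no rational line (this module) — and in neither non-rational kind does `1/[k(x′):k(x)]` bound the
order; the candidate replacement is `2/(ν(x′)+1)` (Chudnovsky), `= 1` exactly on rational lines.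
-/

namespace Literature.AlgebraicGeometry.CossartPiltant200819.OrderAtClosedPointOffLines

open MvPolynomial

open Literature.AlgebraicGeometry.CossartPiltant200819.OrderAtClosedPoint
  (derivation_apply_mem_pow)

/-! ### The closed point `x′ = (θ, θ²)` of `𝔸²_k`, `θ` a root of an irreducible `P ∈ k[T]` -/

section General

variable {k : Type*} [Field k] (P : Polynomial k)

/-- Killing `w₃ − w₂²`: `f − f(w₂, w₂²) ∈ (w₃ − w₂²)`. [folklore] -/
theorem sub_aeval_sq_mem_span (f : MvPolynomial (Fin 2) k) :
    f - MvPolynomial.aeval ![(X 0 : MvPolynomial (Fin 2) k), X 0 ^ 2] f ∈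
      Ideal.span {(X 1 - X 0 ^ 2 : MvPolynomial (Fin 2) k)} := by
  induction f using MvPolynomial.induction_on with
  | C r => simp
  | add p q hp hq =>
    have : p + q - MvPolynomial.aeval ![(X 0 : MvPolynomial (Fin 2) k), X 0 ^ 2] (p + q)
        = (p - MvPolynomial.aeval ![(X 0 : MvPolynomial (Fin 2) k), X 0 ^ 2] p)
          + (q - MvPolynomial.aeval ![(X 0 : MvPolynomial (Fin 2) k), X 0 ^ 2] q) := by
      rw [map_add]; ring
    rw [this]; exact Ideal.add_mem _ hp hq
  | mul_X p i hp =>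
    have hi : i = 0 ∨ i = 1 := by
      rcases i with ⟨i, hi⟩
      rcases i with _ | i
      · exact Or.inl rfl
      · rcases i with _ | i
        · exact Or.inr rfl
        · omega
    rcases hi with rfl | rfl
    · have : p * X 0 - MvPolynomial.aeval ![(X 0 : MvPolynomial (Fin 2) k), X 0 ^ 2] (p * X 0)
          = (p - MvPolynomial.aeval ![(X 0 : MvPolynomial (Fin 2) k), X 0 ^ 2] p) * X 0 := by
        simp; ring
      rw [this]; exact Ideal.mul_mem_right _ _ hp
    · have : p * X 1 - MvPolynomial.aeval ![(X 0 : MvPolynomial (Fin 2) k), X 0 ^ 2] (p * X 1)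
          = (p - MvPolynomial.aeval ![(X 0 : MvPolynomial (Fin 2) k), X 0 ^ 2] p) * X 1
            + MvPolynomial.aeval ![(X 0 : MvPolynomial (Fin 2) k), X 0 ^ 2] p * (X 1 - X 0 ^ 2) := by
        simp; ring
      rw [this]
      exact Ideal.add_mem _ (Ideal.mul_mem_right _ _ hp)
        (Ideal.mul_mem_left _ _ (Ideal.subset_span rfl))

/-- The restriction to the conic `w₃ = w₂²` factors through `k[T]`, `T ↦ w₂`. [folklore] -/
theorem aeval_X0_aeval_T_sq (f : MvPolynomial (Fin 2) k) :
    Polynomial.aeval (X 0 : MvPolynomial (Fin 2) k)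
        (MvPolynomial.aeval ![(Polynomial.X : Polynomial k), Polynomial.X ^ 2] f)
      = MvPolynomial.aeval ![(X 0 : MvPolynomial (Fin 2) k), X 0 ^ 2] f := by
  have : (Polynomial.aeval (X 0 : MvPolynomial (Fin 2) k)).comp
      (MvPolynomial.aeval ![(Polynomial.X : Polynomial k), Polynomial.X ^ 2])
        = MvPolynomial.aeval ![(X 0 : MvPolynomial (Fin 2) k), X 0 ^ 2] := by
    apply MvPolynomial.algHom_ext
    intro i
    fin_cases i <;> simp
  exact AlgHom.congr_fun this f

/-- `w₂ ↦ θ, w₃ ↦ θ²` onto `k(θ) = k[T]/(P)` is surjective. [folklore] -/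
theorem aeval_root_sq_surjective :
    Function.Surjective
      (MvPolynomial.aeval ![AdjoinRoot.root P, AdjoinRoot.root P ^ 2] :
        MvPolynomial (Fin 2) k →ₐ[k] AdjoinRoot P) := by
  intro x
  induction x using AdjoinRoot.induction_on with
  | ih g =>
    refine ⟨Polynomial.aeval (X 0 : MvPolynomial (Fin 2) k) g, ?_⟩
    rw [← Polynomial.aeval_algHom_apply]
    simp [AdjoinRoot.aeval_eq]

/-- The kernel of `w₂ ↦ θ, w₃ ↦ θ²` is `𝔪 = (P(w₂), w₃ − w₂²)`. [folklore] -/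
theorem ker_aeval_root_sq_eq :
    RingHom.ker (MvPolynomial.aeval ![AdjoinRoot.root P, AdjoinRoot.root P ^ 2] :
        MvPolynomial (Fin 2) k →ₐ[k] AdjoinRoot P)
      = Ideal.span {Polynomial.aeval (X 0 : MvPolynomial (Fin 2) k) P, X 1 - X 0 ^ 2} := by
  set ψ := (MvPolynomial.aeval ![AdjoinRoot.root P, AdjoinRoot.root P ^ 2] :
        MvPolynomial (Fin 2) k →ₐ[k] AdjoinRoot P) with hψ
  have hX0 : ψ (X 0) = AdjoinRoot.root P := by simp [hψ]
  have hX1 : ψ (X 1) = AdjoinRoot.root P ^ 2 := by simp [hψ]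
  have hP0 : ψ (Polynomial.aeval (X 0 : MvPolynomial (Fin 2) k) P) = 0 := by
    rw [← Polynomial.aeval_algHom_apply, hX0, AdjoinRoot.aeval_eq, AdjoinRoot.mk_self]
  have hD0 : ψ (X 1 - X 0 ^ 2) = 0 := by rw [map_sub, map_pow, hX0, hX1, sub_self]
  apply le_antisymm
  · intro f hf
    rw [RingHom.mem_ker] at hf
    set g := MvPolynomial.aeval ![(Polynomial.X : Polynomial k), Polynomial.X ^ 2] f with hg
    have hA := sub_aeval_sq_mem_span f
    rw [← aeval_X0_aeval_T_sq] at hA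
    have hspan : Ideal.span {(X 1 - X 0 ^ 2 : MvPolynomial (Fin 2) k)} ≤ RingHom.ker ψ := by
      rw [Ideal.span_le, Set.singleton_subset_iff]; exact hD0
    have hg0 : ψ (Polynomial.aeval (X 0 : MvPolynomial (Fin 2) k) g) = 0 := by
      have := hspan hA
      rw [RingHom.mem_ker, map_sub, hf, zero_sub, neg_eq_zero] at this
      exact this
    rw [← Polynomial.aeval_algHom_apply, hX0, AdjoinRoot.aeval_eq, AdjoinRoot.mk_eq_zero] at hg0
    obtain ⟨h, hh⟩ := hg0
    have hgm : Polynomial.aeval (X 0 : MvPolynomial (Fin 2) k) g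
        ∈ Ideal.span {Polynomial.aeval (X 0 : MvPolynomial (Fin 2) k) P, X 1 - X 0 ^ 2} := by
      rw [hh, map_mul]
      exact Ideal.mul_mem_right _ _ (Ideal.subset_span (by simp))
    have hsub : f - Polynomial.aeval (X 0 : MvPolynomial (Fin 2) k) g
        ∈ Ideal.span {Polynomial.aeval (X 0 : MvPolynomial (Fin 2) k) P, X 1 - X 0 ^ 2} :=
      Ideal.span_mono (by simp) hA
    simpa using Ideal.add_mem _ hsub hgm
  · rw [Ideal.span_le]
    intro x hx
    simp only [Set.mem_insert_iff, Set.mem_singleton_iff] at hx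
    rcases hx with rfl | rfl
    · exact hP0
    · exact hD0

/-- `x′ = (θ, θ²)` is a closed point: `𝔪` is maximal (`P` irreducible). [folklore] -/
theorem isMaximal (hP : Irreducible P) :
    Ideal.IsMaximal
      (Ideal.span {Polynomial.aeval (X 0 : MvPolynomial (Fin 2) k) P, X 1 - X 0 ^ 2}) := by
  haveI := Fact.mk hP
  rw [← ker_aeval_root_sq_eq P]
  exact RingHom.ker_isMaximal_of_surjective _ (aeval_root_sq_surjective P)

/-- Its residue field is `k(θ)`, of degree `deg P` over `k`. [folklore] -/
theorem finrank_residueField (hP0 : P ≠ 0) :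
    Module.finrank k (MvPolynomial (Fin 2) k ⧸
        (Ideal.span {Polynomial.aeval (X 0 : MvPolynomial (Fin 2) k) P, X 1 - X 0 ^ 2}))
      = P.natDegree := by
  have e : (MvPolynomial (Fin 2) k ⧸
      (Ideal.span {Polynomial.aeval (X 0 : MvPolynomial (Fin 2) k) P, X 1 - X 0 ^ 2}))
        ≃ₐ[k] AdjoinRoot P :=
    (Ideal.quotientEquivAlgOfEq k (ker_aeval_root_sq_eq P).symm).trans
      (Ideal.quotientKerAlgEquivOfSurjective (aeval_root_sq_surjective P))
  rw [e.toLinearEquiv.finrank_eq, PowerBasis.finrank (AdjoinRoot.powerBasis hP0),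
    AdjoinRoot.powerBasis_dim]

/-- **`x′` lies on no `k`-rational line** when `deg P ≥ 3`: no nonzero affine-linear polynomial
`a + b·w₂ + c·w₃` lies in `𝔪` (its image `a + bθ + cθ²` in `k(θ)` vanishes only if `P ∣ a + bT + cT²`,
impossible by degree). So the initial degree of the point is `ν(x′) = 2`, attained by the conic
`w₃ − w₂² ∈ 𝔪`. [folklore] -/
theorem linear_not_mem (hP : 3 ≤ P.natDegree) (a b c : k) (habc : ¬ (a = 0 ∧ b = 0 ∧ c = 0)) :
    C a + C b * X 0 + C c * X 1 ∉
      Ideal.span {Polynomial.aeval (X 0 : MvPolynomial (Fin 2) k) P, X 1 - X 0 ^ 2} := by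
  intro hmem
  rw [← ker_aeval_root_sq_eq P, RingHom.mem_ker] at hmem
  set q : Polynomial k := Polynomial.C a + Polynomial.C b * Polynomial.X + Polynomial.C c * Polynomial.X ^ 2
    with hq
  have himg : (MvPolynomial.aeval ![AdjoinRoot.root P, AdjoinRoot.root P ^ 2] :
        MvPolynomial (Fin 2) k →ₐ[k] AdjoinRoot P) (C a + C b * X 0 + C c * X 1)
      = AdjoinRoot.mk P q := by
    rw [← AdjoinRoot.aeval_eq]
    simp [hq]
  rw [himg, AdjoinRoot.mk_eq_zero] at hmem
  have hq0 : q ≠ 0 := by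
    intro h0
    apply habc
    have h1 : q.coeff 0 = a := by simp [hq]
    have h2 : q.coeff 1 = b := by simp [hq]
    have h3 : q.coeff 2 = c := by simp [hq]
    rw [h0] at h1 h2 h3
    simp at h1 h2 h3
    exact ⟨h1.symm, h2.symm, h3.symm⟩
  have hdeg : q.natDegree ≤ 2 := by
    rw [hq]; compute_degree!
  have := Polynomial.natDegree_le_of_dvd hmem hq0
  omega

/-- The conic through `x′`: `w₃ − w₂² ∈ 𝔪`, of total degree `2`. [folklore] -/
theorem conic_mem :
    (X 1 - X 0 ^ 2 : MvPolynomial (Fin 2) k) ∈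
      Ideal.span {Polynomial.aeval (X 0 : MvPolynomial (Fin 2) k) P, X 1 - X 0 ^ 2} ∧
    (X 1 - X 0 ^ 2 : MvPolynomial (Fin 2) k).totalDegree ≤ 2 := by
  refine ⟨Ideal.subset_span (by simp), ?_⟩
  refine (totalDegree_sub _ _).trans (max_le ?_ ?_)
  · rw [totalDegree_X]; omega
  · rw [totalDegree_X_pow]

end General

/-! ### Over `𝔽₂` with `θ³ + θ + 1 = 0`: a cubic of order exactly two at `x′ = (θ, θ²)` -/

section F2

/-- `deg (T³ + T + 1) = 3` over `𝔽₂`. [folklore] -/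
theorem P2_natDegree :
    (Polynomial.X ^ 3 + Polynomial.X + 1 : Polynomial (ZMod 2)).natDegree = 3 := by
  compute_degree!

/-- `T³ + T + 1` is irreducible over `𝔽₂` (degree `3`, no root). [folklore] -/
theorem P2_irreducible :
    Irreducible (Polynomial.X ^ 3 + Polynomial.X + 1 : Polynomial (ZMod 2)) := by
  refine Polynomial.irreducible_of_degree_le_three_of_not_isRoot (by rw [P2_natDegree]; decide) ?_
  intro x
  have : ∀ a : ZMod 2, a ^ 3 + a + 1 ≠ 0 := by decide
  simpa [Polynomial.IsRoot] using this x

/-- `P(w₂) = w₂³ + w₂ + 1`. [folklore] -/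
theorem aeval_P2 :
    Polynomial.aeval (X 0 : MvPolynomial (Fin 2) (ZMod 2))
        (Polynomial.X ^ 3 + Polynomial.X + 1 : Polynomial (ZMod 2))
      = X 0 ^ 3 + X 0 + 1 := by
  simp

/-- The cubic `C = 1 + w₃² + w₃³ + w₂w₃ + w₂² + w₂²w₃ + w₂³ ∈ 𝔽₂[w₂,w₃]` — over `𝔽₈` it is the product of the
three lines through the pairs of conjugates of `x′ = (θ, θ²)` (`C = N_{𝔽₈/𝔽₂}(θ² + w₂θ + w₃ + 1)`) — written
on the generators of `𝔪²`: `C = P(w₂)² + w₂·P(w₂)·(w₃ − w₂²) + (1 + w₃)·(w₃ − w₂²)²` (an identity modulo `2`).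
[folklore] -/
theorem cubic_eq :
    (1 + X 1 ^ 2 + X 1 ^ 3 + X 0 * X 1 + X 0 ^ 2 + X 0 ^ 2 * X 1 + X 0 ^ 3 :
        MvPolynomial (Fin 2) (ZMod 2))
      = (X 0 ^ 3 + X 0 + 1) ^ 2 + X 0 * (X 0 ^ 3 + X 0 + 1) * (X 1 - X 0 ^ 2)
          + (1 + X 1) * (X 1 - X 0 ^ 2) ^ 2 := by
  have h2 : (2 : MvPolynomial (Fin 2) (ZMod 2)) = 0 := by
    have := CharP.cast_eq_zero (MvPolynomial (Fin 2) (ZMod 2)) 2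
    simpa using this
  linear_combination (-(X 0 : MvPolynomial (Fin 2) (ZMod 2)) + X 0 ^ 2 * X 1 + X 0 ^ 2 * X 1 ^ 2
    - X 0 ^ 4 - X 0 ^ 4 * X 1) * h2

/-- `C` has order `≥ 2` at `x′`: `C ∈ 𝔪²`. [folklore] -/
theorem cubic_mem_sq :
    (1 + X 1 ^ 2 + X 1 ^ 3 + X 0 * X 1 + X 0 ^ 2 + X 0 ^ 2 * X 1 + X 0 ^ 3 :
        MvPolynomial (Fin 2) (ZMod 2))
      ∈ (Ideal.span {Polynomial.aeval (X 0 : MvPolynomial (Fin 2) (ZMod 2))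
          (Polynomial.X ^ 3 + Polynomial.X + 1 : Polynomial (ZMod 2)), X 1 - X 0 ^ 2}) ^ 2 := by
  rw [cubic_eq, aeval_P2]
  set M : Ideal (MvPolynomial (Fin 2) (ZMod 2)) :=
    Ideal.span {(X 0 ^ 3 + X 0 + 1 : MvPolynomial (Fin 2) (ZMod 2)), X 1 - X 0 ^ 2} with hM
  have hP : (X 0 ^ 3 + X 0 + 1 : MvPolynomial (Fin 2) (ZMod 2)) ∈ M := Ideal.subset_span (by simp)
  have hD : (X 1 - X 0 ^ 2 : MvPolynomial (Fin 2) (ZMod 2)) ∈ M := Ideal.subset_span (by simp)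
  have hMM : M * M = M ^ 2 := (pow_two M).symm
  refine Ideal.add_mem _ (Ideal.add_mem _ (Ideal.pow_mem_pow hP 2) ?_) ?_
  · rw [mul_assoc]
    exact Ideal.mul_mem_left _ _ (hMM ▸ Ideal.mul_mem_mul hP hD)
  · exact Ideal.mul_mem_left _ _ (Ideal.pow_mem_pow hD 2)

/-- `∂C/∂w₃ = w₃² + w₂ + w₂²` in characteristic `2`. [folklore] -/
theorem pderiv_one_cubic :
    pderiv 1 (1 + X 1 ^ 2 + X 1 ^ 3 + X 0 * X 1 + X 0 ^ 2 + X 0 ^ 2 * X 1 + X 0 ^ 3 :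
        MvPolynomial (Fin 2) (ZMod 2)) = X 1 ^ 2 + X 0 + X 0 ^ 2 := by
  have h2 : (2 : MvPolynomial (Fin 2) (ZMod 2)) = 0 := by
    have := CharP.cast_eq_zero (MvPolynomial (Fin 2) (ZMod 2)) 2
    simpa using this
  have h01 : (0 : Fin 2) ≠ 1 := by decide
  simp only [map_add, Derivation.map_one_eq_zero, Derivation.leibniz_pow, Derivation.leibniz,
    pderiv_X_self, pderiv_X_of_ne h01, smul_eq_mul, mul_one, mul_zero, smul_zero, add_zero, zero_add]
  norm_num
  linear_combination (X 1 + X 1 ^ 2 : MvPolynomial (Fin 2) (ZMod 2)) * h2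

/-- `∂²C/∂w₂∂w₃ = ∂(w₃² + w₂ + w₂²)/∂w₂ = 1` in characteristic `2`. [folklore] -/
theorem pderiv_pderiv_cubic :
    pderiv 0 (pderiv 1 (1 + X 1 ^ 2 + X 1 ^ 3 + X 0 * X 1 + X 0 ^ 2 + X 0 ^ 2 * X 1 + X 0 ^ 3 :
        MvPolynomial (Fin 2) (ZMod 2))) = 1 := by
  have h2 : (2 : MvPolynomial (Fin 2) (ZMod 2)) = 0 := by
    have := CharP.cast_eq_zero (MvPolynomial (Fin 2) (ZMod 2)) 2
    simpa using this
  have h10 : (1 : Fin 2) ≠ 0 := by decide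
  rw [pderiv_one_cubic]
  simp only [map_add, Derivation.leibniz_pow, pderiv_X_self, pderiv_X_of_ne h10, smul_eq_mul, mul_one]
  norm_num
  exact h2

/-- `C` has order EXACTLY `2` at `x′`: `C ∉ 𝔪³` (two derivations lower the order by two, and
`∂²C/∂w₂∂w₃ = 1 ∉ 𝔪`). [folklore] -/
theorem cubic_not_mem_cube :
    (1 + X 1 ^ 2 + X 1 ^ 3 + X 0 * X 1 + X 0 ^ 2 + X 0 ^ 2 * X 1 + X 0 ^ 3 :
        MvPolynomial (Fin 2) (ZMod 2))
      ∉ (Ideal.span {Polynomial.aeval (X 0 : MvPolynomial (Fin 2) (ZMod 2))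
          (Polynomial.X ^ 3 + Polynomial.X + 1 : Polynomial (ZMod 2)), X 1 - X 0 ^ 2}) ^ 3 := by
  intro h
  have h1 := derivation_apply_mem_pow (pderiv (1 : Fin 2)) _ 2 h
  have h0 := derivation_apply_mem_pow (pderiv (0 : Fin 2)) _ 1 h1
  rw [pderiv_pderiv_cubic, pow_one] at h0
  exact (isMaximal _ P2_irreducible).ne_top ((Ideal.eq_top_iff_one _).mpr h0)

/-- `deg C ≤ 3`. [folklore] -/
theorem cubic_totalDegree_le :
    (1 + X 1 ^ 2 + X 1 ^ 3 + X 0 * X 1 + X 0 ^ 2 + X 0 ^ 2 * X 1 + X 0 ^ 3 :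
        MvPolynomial (Fin 2) (ZMod 2)).totalDegree ≤ 3 := by
  have hX : ∀ (i : Fin 2) (n : ℕ), ((X i : MvPolynomial (Fin 2) (ZMod 2)) ^ n).totalDegree ≤ n :=
    fun i n => (totalDegree_pow _ _).trans (by rw [totalDegree_X]; omega)
  have hadd : ∀ (p q : MvPolynomial (Fin 2) (ZMod 2)) (n : ℕ),
      p.totalDegree ≤ n → q.totalDegree ≤ n → (p + q).totalDegree ≤ n :=
    fun p q n hp hq => (totalDegree_add p q).trans (max_le hp hq)
  refine hadd _ _ 3 (hadd _ _ 3 (hadd _ _ 3 (hadd _ _ 3 (hadd _ _ 3 (hadd _ _ 3 ?_ ?_) ?_) ?_) ?_) ?_)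
    (hX 0 3)
  · rw [totalDegree_one]; omega
  · exact (hX 1 2).trans (by omega)
  · exact hX 1 3
  · exact (totalDegree_mul _ _).trans (by rw [totalDegree_X, totalDegree_X]; omega)
  · exact (hX 0 2).trans (by omega)
  · exact (totalDegree_mul _ _).trans ((add_le_add (hX 0 2) (totalDegree_X (1 : Fin 2)).le))

/-- **Case (G) witness** (OBSTRUCTIONS-DIM4 §35.11): at the closed point `x′ = (θ, θ²) ∈ 𝔸²_{𝔽₂}`,
`θ³ + θ + 1 = 0` — residue degree `d = 3`, on NO `𝔽₂`-rational line — the cubic `C` has order exactly `2`;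
so "order ≤ degree/d" ((22)(ii) one dimension up) fails off rational lines too (`2 > 3/3`), while
Chudnovsky's bound `order ≤ 2·degree/(ν(x′)+1) = 2·3/3` is attained. [folklore] -/
theorem caseG_witness :
    let M : Ideal (MvPolynomial (Fin 2) (ZMod 2)) :=
      Ideal.span {Polynomial.aeval (X 0 : MvPolynomial (Fin 2) (ZMod 2))
        (Polynomial.X ^ 3 + Polynomial.X + 1 : Polynomial (ZMod 2)), X 1 - X 0 ^ 2}
    let Cub : MvPolynomial (Fin 2) (ZMod 2) :=
      1 + X 1 ^ 2 + X 1 ^ 3 + X 0 * X 1 + X 0 ^ 2 + X 0 ^ 2 * X 1 + X 0 ^ 3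
    M.IsMaximal ∧ Module.finrank (ZMod 2) (MvPolynomial (Fin 2) (ZMod 2) ⧸ M) = 3 ∧
      (∀ a b c : ZMod 2, ¬ (a = 0 ∧ b = 0 ∧ c = 0) → C a + C b * X 0 + C c * X 1 ∉ M) ∧
      Cub ∈ M ^ 2 ∧ Cub ∉ M ^ 3 ∧ Cub.totalDegree ≤ 3 ∧ ¬ ((2 : ℚ) ≤ 3 / 3) := by
  intro M Cub
  refine ⟨isMaximal _ P2_irreducible, ?_, ?_, cubic_mem_sq, cubic_not_mem_cube,
    cubic_totalDegree_le, by norm_num⟩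
  · rw [finrank_residueField _ P2_irreducible.ne_zero, P2_natDegree]
  · intro a b c h
    exact linear_not_mem _ (by rw [P2_natDegree]) a b c h

/-- **II.5.3.2 (i) one dimension up fails off rational lines as well**: `G := C·(w₃ − w₂²)` has order
`≥ 3` at `x′` and degree `≤ 5`, and is not a square (`∂G/∂w₃ ≠ 0`), while the verbatim two-parameter
transcription of II.5.3.2 (i) would give order `≤ 1 + 5/3 < 3`; Chudnovsky's `2·5/3 ≥ 3` is respected.
[folklore] -/
theorem caseG_violates_verbatim :
    let M : Ideal (MvPolynomial (Fin 2) (ZMod 2)) :=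
      Ideal.span {Polynomial.aeval (X 0 : MvPolynomial (Fin 2) (ZMod 2))
        (Polynomial.X ^ 3 + Polynomial.X + 1 : Polynomial (ZMod 2)), X 1 - X 0 ^ 2}
    let G : MvPolynomial (Fin 2) (ZMod 2) :=
      (1 + X 1 ^ 2 + X 1 ^ 3 + X 0 * X 1 + X 0 ^ 2 + X 0 ^ 2 * X 1 + X 0 ^ 3) * (X 1 - X 0 ^ 2)
    G ∈ M ^ 3 ∧ G.totalDegree ≤ 5 ∧ pderiv 1 G ≠ 0 ∧ (1 : ℚ) + 5 / 3 < 3 := by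
  intro M G
  refine ⟨?_, ?_, ?_, by norm_num⟩
  · rw [pow_succ]
    exact Ideal.mul_mem_mul cubic_mem_sq (Ideal.subset_span (by simp))
  · refine (totalDegree_mul _ _).trans ?_
    have := cubic_totalDegree_le
    have h2 := (conic_mem (k := ZMod 2) (Polynomial.X ^ 3 + Polynomial.X + 1)).2
    omega
  · intro h0
    have hev := congrArg (MvPolynomial.eval (0 : Fin 2 → ZMod 2)) h0
    have h01 : (0 : Fin 2) ≠ 1 := by decide
    rw [Derivation.leibniz, pderiv_one_cubic, Derivation.map_sub, Derivation.leibniz_pow,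
      pderiv_X_self, pderiv_X_of_ne h01] at hev
    simp at hev

end F2

end Literature.AlgebraicGeometry.CossartPiltant200819.OrderAtClosedPointOffLines
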